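import Summits.ResolutionOfSingularities.ResolutionOfSingularities.Theorems.EquisingularLiftEquisingularLiftBlowupModelOfChain
import Summits.ResolutionOfSingularities.ResolutionOfSingularities.Theorems.EquisingularLiftEquisingularLiftNatNoseDescSharpEngine
import Summits.ResolutionOfSingularities.ResolutionOfSingularities.Theorems.EquisingularLiftEquisingularLiftNatLargeCharDoorCurrency
import Summits.ResolutionOfSingularities.ResolutionOfSingularities.Theorems.EquisingularLiftEquisingularLiftNatHypLocPrincipalForm
import HarnessLib

/-!
# Crux `EquisingularLift` (stmt-ResolutionOfSingularities-15660), line `Sketch` (skeleton v10c `f3e6993bf39ec5c9`):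
# RUNG LC IN THE LINE'S OWN CURRENCY — regular blow-up models (= projective resolutions) of degree-`d` hypersurfaces of `ℙⁿ_k̄`
# in every characteristic `p > M(n, d)`

[OURS · leafhand-res-equisingularlift-6 g1, 2026-08-31] AI-produced, weaker than expert review; NOT a statement of any
manuscript; nothing here proves resolution of singularities in positive characteristic, and NO registered stub is closed.

The open residual of the line is `stub_blowupModel_ge_five` (regular blow-up models of integral hypersurfaces of `ℙⁿ_k̄`, `n ≥ 5`
⟺ their PROJECTIVE resolution, `blowupModels_ge_five_iff_projectiveResolutions_ge_five`, p816118).  The route's rung LC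
(`descDoorSharp_largeChar`, p811794/p812631: in characteristic `p > M(n, d)` every integral degree-`d` hypersurface `H ⊆ ℙⁿ_k̄`
carries the smooth-parameter descent door `DescDoorSharp`) was so far cashed only as `ELNatConclusionO` (EL♮'s conclusion) and as
`HasResolution` (`hasResolution_largeChar`, p814390).  This file cashes it in the LINE's currency:

* `exists_chain_of_descDoorSharp` — **the descent door READ OVER `k` ITSELF**: the `O`-uniform engine `descDoorAt_elnat_of_base`
  (p793810 lineage, ✓ `…NatNoseDescSharpEngine`) instantiated at `O := k`, `π := id`, `φ := id` (so `Proj.map φ = 𝟙`,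
  `Proj.map_id`) turns `DescDoorSharp k n H ι` into a `Split.Chain` over `(ℙⁿ_k, range ι)` — blow-ups of `ℙⁿ_k` in REGULAR
  centres off the generic point — with REGULAR reduced last strict transform (the E1 and flatness tokens of the `O`-chain are
  simply dropped);
* `exists_projectiveResolution_of_descDoorSharp` / `blowupModel_of_descDoorSharp` — hence (`…BlowupModelOfChain`: the chain's
  reduced end is a resolution with projective source; Liu 2002 Thm. 8.1.24, DISCHARGED) a resolution of `H` with projective
  source and a regular blow-up model of `H`;
* ★ `blowupModel_largeChar` — **`∀ n d, ∃ M, ∀ p > M`: every integral degree-`d` hypersurface `H ⊆ ℙⁿ_k` (`k` algebraically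
  closed of characteristic `p`, `ι` a closed immersion with `range ι = V₊(F)`, `F ≠ 0` homogeneous of degree `d`) has a non-zero
  ideal sheaf ALL of whose blow-ups are regular** — the conclusion of `stub_blowupModel_ge_five` (and of the `n = 3, 4` leaves),
  degree by degree, in large characteristic; `projectiveResolution_largeChar` — the same as a projective resolution;
* `blowupModel_largeChar_of_hyp` — the rung in the leaves' own binders (closed immersion, integral, locally principal ideal) plus
  «`ι` iso or `range ι` on a hypersurface of degree `≤ D`»; `blowupModels_of_smallChar` / `blowupModels_ge_five_of_smallChar` — the
  leaves' currency (every `n`; resp. the registered residual on `5 ≤ n`, VERBATIM) follows from its instances at prime-form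
  hypersurfaces of degree `e` in the finitely many characteristics `p ≤ M(n, e)` (a re-location: `M` is ineffective).

Honest label: a RUNG (`M = M(n, d)` ineffective and degree-dependent; at a fixed `p` infinitely many degrees remain), uniform in
`n`; it closes NO registered stub (those quantify over all `p` and all degrees) and is NOT resolution of singularities in
characteristic `p`.  `--supports stmt-ResolutionOfSingularities-15660 --as helper`, DEF-FREE, standard axioms, ZERO named
hypotheses.

References: [Liu2002, Thm. 8.1.24, Prop. 3.1.9]; [Hartshorne1977, II.7.17, II Prop. 7.16 (c)]; [GortzWedhorn2020, Prop. 13.91].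
-/

set_option linter.dupNamespace false -- mandated namespace `Summit.<Summit>.<Problem>` of this single-conjunct summit

noncomputable section

open CategoryTheory CategoryTheory.Limits AlgebraicGeometry TopologicalSpace Topology
open Literature.AlgebraicGeometry.Resolution Literature.AlgebraicGeometry.Motives
open AlgebraicGeometry.Scheme.IdealSheafData
open Summit.ResolutionOfSingularities.ResolutionOfSingularities.Theses.EquisingularLift.Split
open Summit.ResolutionOfSingularities.ResolutionOfSingularities.Cruxes.EquisingularLiftNat.Sections

namespace Summit.ResolutionOfSingularities.ResolutionOfSingularities.Cruxes.EquisingularLift.StrataSplit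

/-! ## The descent door read over `k`: a chain of blow-ups of `ℙⁿ_k` with regular reduced end -/

/-- **The smooth-parameter descent door, read over `k` itself, is an embedded resolution of `range ι ⊆ ℙⁿ_k` in the crux's chain
format.** If `DescDoorSharp k n H ι` (a `B`-tower of blow-ups of `ℙⁿ_B` with `B`-smooth centres and `B`-flat exceptional divisors,
`B` formally smooth over `ℤ[1/N]`, `θ : B → k`, whose fibre over `θ` resolves `range ι`), then some `(P', σ, S')` is reached from
`(ℙⁿ_k, 𝟙, range ι)` by blow-ups in REGULAR centres off the generic point (`Split.Chain`) and the reduced closed subscheme on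
`closure S'` is regular: the `O`-uniform engine `descDoorAt_elnat_of_base` at `O := k`, `π := id_k`, `φ := id` (`Proj.map id = 𝟙`),
forgetting the flatness and E1 tokens of its induction principle. [cite: Liu2002, Prop. 3.1.9 and Ex. 3.1.10]
[cite: GortzWedhorn2020, Prop. 13.91] -/
theorem exists_chain_of_descDoorSharp (k : Type) [Field k] (n : ℕ) (H : Scheme.{0})
    (ι : H ⟶ (projectiveSpace n k).left) (hD : DescDoorSharp k n H ι) :
    ∃ (P' : Scheme.{0}) (σ : P' ⟶ (projectiveSpace n k).left) (S' : Set P'),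
      Chain (projectiveSpace n k).left (Set.range ι) P' σ S' ∧
      Scheme.IsRegular (vanishingIdeal (⟨closure S', isClosed_closure⟩ : Closeds P')).subscheme := by
  classical
  letI := MvPolynomial.gradedAlgebra (σ := Fin (n + 1)) (R := k)
  obtain ⟨N, -, B, _, _, _, θ, hDAt⟩ := hD
  letI : Algebra B k := θ.toAlgebra
  have hθ₀ : θ = (RingHom.id k).comp (algebraMap B k) := by
    rw [RingHom.id_comp]
    exact (RingHom.algebraMap_toAlgebra θ).symm
  -- the identity graded homomorphism and `Proj.map id = 𝟙`
  let φ : MvPolynomial.homogeneousSubmodule (Fin (n + 1)) k →+*ᵍ MvPolynomial.homogeneousSubmodule (Fin (n + 1)) k :=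
    GradedRingHom.id _
  have hφ' : HomogeneousIdeal.irrelevant (MvPolynomial.homogeneousSubmodule (Fin (n + 1)) k) ≤
      (HomogeneousIdeal.irrelevant (MvPolynomial.homogeneousSubmodule (Fin (n + 1)) k)).map φ := by
    simp [φ]
  have hφ : ∀ s, φ s = MvPolynomial.map (RingHom.id k) s := fun s => by
    rw [MvPolynomial.map_id]; rfl
  have hJ : Proj.map φ hφ' = 𝟙 (Proj (MvPolynomial.homogeneousSubmodule (Fin (n + 1)) k)) := Proj.map_id
  have h1 : (ι ≫ Proj.map φ hφ' : H ⟶ Proj (MvPolynomial.homogeneousSubmodule (Fin (n + 1)) k)) = ι := by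
    rw [hJ]; exact Category.comp_id ι
  have hY : Set.range ι = Set.range (ι ≫ Proj.map φ hφ' :
      H ⟶ Proj (MvPolynomial.homogeneousSubmodule (Fin (n + 1)) k)) :=
    congrArg (fun f : H ⟶ Proj (MvPolynomial.homogeneousSubmodule (Fin (n + 1)) k) => Set.range f) h1.symm
  have hsurj : Function.Surjective (RingHom.id k) := fun x => ⟨x, rfl⟩
  obtain ⟨P', σ, S', hnat, hreg⟩ := descDoorAt_elnat_of_base B k (Scheme.isRegular_Spec (.of k)) k (RingHom.id k)
    hsurj n H ι θ hθ₀ hDAt φ hφ' hφ (Set.range ι) hY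
  refine ⟨P', σ, S', fun Q hQ₀ hQstep => ?_, hreg⟩
  exact hnat Q hQ₀ fun X' X'' σ' Y' C τ hQ hτ hCreg _ himg _ => hQstep X' X'' σ' Y' C τ hQ hτ hCreg himg

/-- **The descent door gives a resolution with PROJECTIVE source** (integral `H`, closed immersion `ι`): the reduced end of the
chain `exists_chain_of_descDoorSharp` (`exists_projectiveResolution_of_chain`). [cite: Hartshorne1977, II Prop. 7.16 (c)]
[cite: GortzWedhorn2020, Prop. 13.91 (3)] -/
theorem exists_projectiveResolution_of_descDoorSharp {k : Type} [Field k] {n : ℕ} {H : Scheme.{0}} [IsIntegral H]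
    (ι : H ⟶ (projectiveSpace n k).left) [IsClosedImmersion ι] (hD : DescDoorSharp k n H ι) :
    ∃ (Z : Scheme.{0}) (π : Z ⟶ H), IsResolution π ∧
      IsProjectiveOver (Over.mk (π ≫ ι ≫ (projectiveSpace n k).hom)) := by
  obtain ⟨P', σ, S', hch, hreg⟩ := exists_chain_of_descDoorSharp k n H ι hD
  exact exists_projectiveResolution_of_chain ι σ S' hch hreg

/-- **The descent door gives a regular blow-up model** (integral `H`, closed immersion `ι`): a non-zero ideal sheaf on `H` all of
whose blow-ups are regular (`blowupModel_of_chain`: projective resolution + Liu 2002 Thm. 8.1.24, DISCHARGED).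
[cite: Liu2002, Thm. 8.1.24] [cite: Hartshorne1977, II.7.17] -/
theorem blowupModel_of_descDoorSharp {k : Type} [Field k] {n : ℕ} {H : Scheme.{0}} [IsIntegral H]
    (ι : H ⟶ (projectiveSpace n k).left) [IsClosedImmersion ι] (hD : DescDoorSharp k n H ι) :
    ∃ 𝔞 : H.IdealSheafData, 𝔞 ≠ ⊥ ∧ ∀ (Z : Scheme.{0}) (π : Z ⟶ H), IsBlowup π 𝔞 → Scheme.IsRegular Z := by
  obtain ⟨P', σ, S', hch, hreg⟩ := exists_chain_of_descDoorSharp k n H ι hD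
  exact blowupModel_of_chain ι σ S' hch hreg

/-! ## The rung: large characteristic, degree by degree -/

/-- ★ **RUNG LC in the line's currency — regular blow-up models of degree-`d` hypersurfaces of `ℙⁿ_k̄` in characteristic
`p > M(n, d)`.** For all `n, d` there is `M` such that for every prime `p > M`, every algebraically closed field `k` of
characteristic `p`, every closed immersion `ι : H ↪ ℙⁿ_k` of an integral scheme with `range ι = V₊(F)` for a non-zero homogeneous
`F` of degree `d`, there is a non-zero ideal sheaf on `H` ALL of whose blow-ups are regular (`descDoorSharp_largeChar` +
`blowupModel_of_descDoorSharp`). `M` is ineffective and depends on the degree: a rung, not a close of `stub_blowupModel_ge_five`.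
[cite: Liu2002, Thm. 8.1.24] [cite: Hartshorne1977, II.7.17] -/
theorem blowupModel_largeChar (n d : ℕ) :
    ∃ M : ℕ, ∀ (p : ℕ), p.Prime → ∀ (k : Type) [Field k] [CharP k p] [IsAlgClosed k], M < p →
      ∀ (H : Scheme.{0}) (ι : H ⟶ (projectiveSpace n k).left) (F : MvPolynomial (Fin (n + 1)) k),
        F.IsHomogeneous d → IsClosedImmersion ι →
        (IsIntegral H ∧ F ≠ 0 ∧
          letI := MvPolynomial.gradedAlgebra (σ := Fin (n + 1)) (R := k)
          Set.range ι = {x : Proj (MvPolynomial.homogeneousSubmodule (Fin (n + 1)) k) | F ∈ x.asHomogeneousIdeal}) →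
        ∃ 𝔞 : H.IdealSheafData, 𝔞 ≠ ⊥ ∧ ∀ (Z : Scheme.{0}) (π : Z ⟶ H), IsBlowup π 𝔞 → Scheme.IsRegular Z := by
  obtain ⟨M, hM⟩ := LargeChar.descDoorSharp_largeChar n d
  refine ⟨M, fun p hp k _ _ _ hMp H ι F hF hι hcut => ?_⟩
  haveI := hι
  haveI : IsIntegral H := hcut.1
  exact blowupModel_of_descDoorSharp ι (hM p hp k hMp H ι F hF hcut)

/-- **RUNG LC as projective resolution**: under the same hypotheses, `H` has a resolution of singularities `π : Z → H` whose source
is projective over `k`. [cite: Hartshorne1977, II Prop. 7.16 (c)] [cite: GortzWedhorn2020, Prop. 13.91 (3)] -/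
theorem projectiveResolution_largeChar (n d : ℕ) :
    ∃ M : ℕ, ∀ (p : ℕ), p.Prime → ∀ (k : Type) [Field k] [CharP k p] [IsAlgClosed k], M < p →
      ∀ (H : Scheme.{0}) (ι : H ⟶ (projectiveSpace n k).left) (F : MvPolynomial (Fin (n + 1)) k),
        F.IsHomogeneous d → IsClosedImmersion ι →
        (IsIntegral H ∧ F ≠ 0 ∧
          letI := MvPolynomial.gradedAlgebra (σ := Fin (n + 1)) (R := k)
          Set.range ι = {x : Proj (MvPolynomial.homogeneousSubmodule (Fin (n + 1)) k) | F ∈ x.asHomogeneousIdeal}) →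
        ∃ (Z : Scheme.{0}) (π : Z ⟶ H), IsResolution π ∧
          IsProjectiveOver (Over.mk (π ≫ ι ≫ (projectiveSpace n k).hom)) := by
  obtain ⟨M, hM⟩ := LargeChar.descDoorSharp_largeChar n d
  refine ⟨M, fun p hp k _ _ _ hMp H ι F hF hι hcut => ?_⟩
  haveI := hι
  haveI : IsIntegral H := hcut.1
  exact exists_projectiveResolution_of_descDoorSharp ι (hM p hp k hMp H ι F hF hcut)

/-! ## The rung in the crux's own binders (closed immersion, integral, locally principal ideal) plus a degree bound -/

/-- ★ **RUNG LC for blow-up models in the crux's currency, isomorphism case included.** For all `n, D` there is `M = M(n, D)` such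
that for every prime `p > M`, every algebraically closed `k` of characteristic `p` and every `(H, ι)` satisfying the HYPOTHESES OF THE
REGISTERED LEAVES (`ι : H ↪ ℙⁿ_k` a closed immersion, `H` integral, `ker ι` locally principal — the binders of `stub_blowupModel_ge_five`
verbatim), IF `ι` is an isomorphism OR `range ι` lies on some hypersurface of degree `≤ D`, THEN `H` has a non-zero ideal sheaf all of
whose blow-ups are regular.  Proof as `elnat_largeChar_of_hyp` (p812631): `ι` iso ⇒ `H ≅ ℙⁿ_k` regular, `𝔞 = ⊤`
(`exists_blowupModel_of_isRegular`); otherwise `range ι = V₊(F)` for a prime form `F` with `deg F ≤ D`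
(`isIso_or_exists_prime_form_range_eq_of_hyp`), and `blowupModel_largeChar n (deg F)` with `M(n, D) := max_{d ≤ D} M(n, d)`.
A RUNG: closes no registered stub. [cite: Liu2002, Thm. 8.1.24] [cite: Hartshorne1977, II.7.17] -/
theorem blowupModel_largeChar_of_hyp (n D : ℕ) :
    ∃ M : ℕ, ∀ (p : ℕ), p.Prime → ∀ (k : Type) [Field k] [CharP k p] [IsAlgClosed k], M < p →
      ∀ (H : Scheme.{0}) (ι : H ⟶ (projectiveSpace n k).left),
        IsClosedImmersion ι → IsIntegral H →
        (∀ y : (projectiveSpace n k).left, ∃ U : (projectiveSpace n k).left.affineOpens,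
          y ∈ (U : (projectiveSpace n k).left.Opens) ∧ (ι.ker.ideal U).IsPrincipal) →
        (IsIso ι ∨ ∃ (e : ℕ) (G : MvPolynomial (Fin (n + 1)) k), e ≤ D ∧ G.IsHomogeneous e ∧ G ≠ 0 ∧
          letI := MvPolynomial.gradedAlgebra (σ := Fin (n + 1)) (R := k)
          Set.range ι ⊆ {x : Proj (MvPolynomial.homogeneousSubmodule (Fin (n + 1)) k) | G ∈ x.asHomogeneousIdeal}) →
        ∃ 𝔞 : H.IdealSheafData, 𝔞 ≠ ⊥ ∧ ∀ (Z : Scheme.{0}) (π : Z ⟶ H), IsBlowup π 𝔞 → Scheme.IsRegular Z := by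
  classical
  choose M hM using fun d => blowupModel_largeChar n d
  refine ⟨(Finset.range (D + 1)).sup M, fun p hp k _ _ _ hMp H ι hι hH hpr hdeg => ?_⟩
  letI := MvPolynomial.gradedAlgebra (σ := Fin (n + 1)) (R := k)
  haveI := hι
  haveI := hH
  rcases hdeg with hiso | ⟨e, G, heD, hG, hG0, hsub⟩
  · -- `ι` an isomorphism: `H ≅ ℙⁿ_k` is regular, `𝔞 = ⊤`
    haveI := hiso
    exact exists_blowupModel_of_isRegular (Scheme.IsRegular.of_iso (inv ι) (isRegular_projectiveSpace n k))
  rcases LargeChar.isIso_or_exists_prime_form_range_eq_of_hyp ι hpr with hiso | ⟨e', F, -, hF, hprime, hgen, hrange⟩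
  · -- `ι` an isomorphism although `G ≠ 0` vanishes on `range ι`: impossible, but the conclusion holds anyway
    haveI := hiso
    exact exists_blowupModel_of_isRegular (Scheme.IsRegular.of_iso (inv ι) (isRegular_projectiveSpace n k))
  · -- `range ι = V₊(F)`, `G ∈ (F)`, `deg F ≤ deg G ≤ D`
    have hGξ : G ∈ ((ι (genericPoint H)).asHomogeneousIdeal).toIdeal :=
      HomogeneousIdeal.mem_iff.2 (hsub ⟨genericPoint H, rfl⟩)
    have hGF : G ∈ Ideal.span {F} := hgen ▸ hGξ
    obtain ⟨Q, hQ⟩ := Ideal.mem_span_singleton'.mp hGF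
    have hdegF : e' ≤ e := by
      have h1 : F.totalDegree = e' := hF.totalDegree hprime.ne_zero
      have h2 : G.totalDegree = e := hG.totalDegree hG0
      have hQ0 : Q ≠ 0 := by rintro rfl; exact hG0 (by rw [← hQ, zero_mul])
      have h3 : (Q * F).totalDegree = Q.totalDegree + F.totalDegree :=
        MvPolynomial.totalDegree_mul_of_isDomain hQ0 hprime.ne_zero
      rw [hQ] at h3
      omega
    have hMe : M e' < p := lt_of_le_of_lt
      (Finset.le_sup (f := M) (Finset.mem_range.2 (by omega))) hMp
    exact hM e' p hp k hMe H ι F hF hι ⟨hH, hprime.ne_zero, hrange⟩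

/-! ## Re-location of the open residual: only SMALL characteristics remain, degree by degree -/

/-- ★ **The line's downstairs currency in EVERY dimension reduces to finitely many characteristics per degree.** Let
`M(n, e) := Classical.choose (blowupModel_largeChar n e)`.  If regular blow-up models are known for the integral hypersurfaces
`range ι = V₊(F)` (`F ≠ 0` of degree `e`, `ι` a closed immersion) of `ℙⁿ_k̄` in the finitely many characteristics `p ≤ M(n, e)` — for
every `n` and `e` — then EVERY `(H, ι)` satisfying the binders of the registered leaves (closed immersion, integral, locally principal
ideal; all `p`, all `n`) has a regular blow-up model: `ι` iso ⇒ regular; else `range ι = V₊(F)` for a prime form `F` of degree `e`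
(`isIso_or_exists_prime_form_range_eq_of_hyp`) and either `p > M(n, e)` (`blowupModel_largeChar`) or `p ≤ M(n, e)` (hypothesis).
HONEST: `M` is ineffective, so no single characteristic is thereby excluded; a re-location of the residual, not a reduction in size.
[cite: Liu2002, Thm. 8.1.24] [cite: Hartshorne1977, II.7.17] -/
theorem blowupModels_of_smallChar
    (hsmall : ∀ (n e p : ℕ), p.Prime → p ≤ Classical.choose (blowupModel_largeChar n e) →
      ∀ (k : Type) [Field k] [CharP k p] [IsAlgClosed k] (H : Scheme.{0}) (ι : H ⟶ (projectiveSpace n k).left)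
        (F : MvPolynomial (Fin (n + 1)) k), F.IsHomogeneous e → IsClosedImmersion ι →
        (IsIntegral H ∧ F ≠ 0 ∧
          letI := MvPolynomial.gradedAlgebra (σ := Fin (n + 1)) (R := k)
          Set.range ι = {x : Proj (MvPolynomial.homogeneousSubmodule (Fin (n + 1)) k) | F ∈ x.asHomogeneousIdeal}) →
        ∃ 𝔞 : H.IdealSheafData, 𝔞 ≠ ⊥ ∧ ∀ (Z : Scheme.{0}) (π : Z ⟶ H), IsBlowup π 𝔞 → Scheme.IsRegular Z) :
    ∀ p : ℕ, p.Prime → ∀ (k : Type) [Field k] [CharP k p] [IsAlgClosed k] (n : ℕ) (H : AlgebraicGeometry.Scheme.{0}) (ι : H ⟶ (Literature.AlgebraicGeometry.Motives.projectiveSpace n k).left), AlgebraicGeometry.IsClosedImmersion ι → AlgebraicGeometry.IsIntegral H → (∀ y : (Literature.AlgebraicGeometry.Motives.projectiveSpace n k).left, ∃ U : (Literature.AlgebraicGeometry.Motives.projectiveSpace n k).left.affineOpens, y ∈ (U : (Literature.AlgebraicGeometry.Motives.projectiveSpace n k).left.Opens) ∧ (ι.ker.ideal U).IsPrincipal) →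 ∃ 𝔞 : H.IdealSheafData, 𝔞 ≠ ⊥ ∧ ∀ (Z : AlgebraicGeometry.Scheme.{0}) (π : Z ⟶ H), Literature.AlgebraicGeometry.Resolution.IsBlowup π 𝔞 → Literature.AlgebraicGeometry.Resolution.Scheme.IsRegular Z := by
  intro p hp k _ _ _ n H ι hι hH hpr
  classical
  letI := MvPolynomial.gradedAlgebra (σ := Fin (n + 1)) (R := k)
  haveI := hι
  haveI := hH
  rcases LargeChar.isIso_or_exists_prime_form_range_eq_of_hyp ι hpr with hiso | ⟨e, F, -, hF, hprime, -, hrange⟩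
  · haveI := hiso
    exact exists_blowupModel_of_isRegular (Scheme.IsRegular.of_iso (inv ι) (isRegular_projectiveSpace n k))
  · by_cases hMp : Classical.choose (blowupModel_largeChar n e) < p
    · exact Classical.choose_spec (blowupModel_largeChar n e) p hp k hMp H ι F hF hι ⟨hH, hprime.ne_zero, hrange⟩
    · exact hsmall n e p hp (not_lt.mp hMp) k H ι F hF hι ⟨hH, hprime.ne_zero, hrange⟩

/-- **The registered open residual `stub_blowupModel_ge_five` from its small-characteristic instances** (the previous theorem read on
the band `5 ≤ n`; right-hand side = the registered signature VERBATIM). [cite: Liu2002, Thm. 8.1.24] -/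
theorem blowupModels_ge_five_of_smallChar
    (hsmall : ∀ (n e p : ℕ), 5 ≤ n → p.Prime → p ≤ Classical.choose (blowupModel_largeChar n e) →
      ∀ (k : Type) [Field k] [CharP k p] [IsAlgClosed k] (H : Scheme.{0}) (ι : H ⟶ (projectiveSpace n k).left)
        (F : MvPolynomial (Fin (n + 1)) k), F.IsHomogeneous e → IsClosedImmersion ι →
        (IsIntegral H ∧ F ≠ 0 ∧
          letI := MvPolynomial.gradedAlgebra (σ := Fin (n + 1)) (R := k)
          Set.range ι = {x : Proj (MvPolynomial.homogeneousSubmodule (Fin (n + 1)) k) | F ∈ x.asHomogeneousIdeal}) →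
        ∃ 𝔞 : H.IdealSheafData, 𝔞 ≠ ⊥ ∧ ∀ (Z : Scheme.{0}) (π : Z ⟶ H), IsBlowup π 𝔞 → Scheme.IsRegular Z) :
    ∀ p : ℕ, p.Prime → ∀ (k : Type) [Field k] [CharP k p] [IsAlgClosed k] (n : ℕ) (H : AlgebraicGeometry.Scheme.{0}) (ι : H ⟶ (Literature.AlgebraicGeometry.Motives.projectiveSpace n k).left), AlgebraicGeometry.IsClosedImmersion ι → AlgebraicGeometry.IsIntegral H → (∀ y : (Literature.AlgebraicGeometry.Motives.projectiveSpace n k).left, ∃ U : (Literature.AlgebraicGeometry.Motives.projectiveSpace n k).left.affineOpens, y ∈ (U : (Literature.AlgebraicGeometry.Motives.projectiveSpace n k).left.Opens) ∧ (ι.ker.ideal U).IsPrincipal) → 5 ≤ n → ∃ 𝔞 : H.IdealSheafData, 𝔞 ≠ ⊥ ∧ ∀ (Z : AlgebraicGeometry.Scheme.{0}) (π : Z ⟶ H), Literature.AlgebraicGeometry.Resolution.IsBlowup π 𝔞 → Literature.AlgebraicGeometry.Resolution.Scheme.IsRegular Z := by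
  intro p hp k _ _ _ n H ι hι hH hpr hn
  classical
  letI := MvPolynomial.gradedAlgebra (σ := Fin (n + 1)) (R := k)
  haveI := hι
  haveI := hH
  rcases LargeChar.isIso_or_exists_prime_form_range_eq_of_hyp ι hpr with hiso | ⟨e, F, -, hF, hprime, -, hrange⟩
  · haveI := hiso
    exact exists_blowupModel_of_isRegular (Scheme.IsRegular.of_iso (inv ι) (isRegular_projectiveSpace n k))
  · by_cases hMp : Classical.choose (blowupModel_largeChar n e) < p
    · exact Classical.choose_spec (blowupModel_largeChar n e) p hp k hMp H ι F hF hι ⟨hH, hprime.ne_zero, hrange⟩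
    · exact hsmall n e p hn hp (not_lt.mp hMp) k H ι F hF hι ⟨hH, hprime.ne_zero, hrange⟩

end Summit.ResolutionOfSingularities.ResolutionOfSingularities.Cruxes.EquisingularLift.StrataSplit

end
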